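import Literature.Geometry.Lorentzian.TameGenericity
import Literature.Geometry.Lorentzian.AFEndRestrict
import Literature.Geometry.Lorentzian.AFEndBreathingFamily
import Literature.Analysis.Calculus.ParametricIteratedFDeriv
import HarnessLib

/-!
# Smooth families of data that are constant off a compact set are TAME (on a collared end)

The tame genericity notion of the final state conjecture (`InitialDataSet.IsTameDataFamily`,
`TameGenericity.lean`: one fixed end, continuous mass, continuity at the base parameter in the
Dafermos–Rodnianski weighted `C² × C¹` distance `AFEnd.wDist`) was introduced to exclude witness
families that recede to infinity with divergent mass. This file proves that the OTHER classical kind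
of witness family — Christodoulou's compactly supported modifications `α₀ + c f`, and more generally
any jointly smooth family `G : ℝᵐ → data` all of whose members agree with `G 0` outside a fixed
compact set `K ⊆ X` (gluing / breathing / gauge-enrichment families) — IS tame, on every collared
restriction `e.restrict` (`AFEndRestrict.lean`) of a sole, Dafermos–Rodnianski-flat end `e` of `G 0`:

* `tendsto_iSup_weight_iteratedFDeriv_sub_nhds_zero` — the calculus: for `Φ : P → E3 → F` jointly
  smooth on `{R < ‖z‖}` with `Φ c = Φ 0` beyond some radius, the weighted suprema
  `⨆_{i ≤ n, R₁ < ‖x‖} ‖x‖^{w+i} ‖Dⁱ(Φ c − Φ 0)(x)‖` tend to `0` as `c → 0` (`R < R₁`): the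
  differences live on a compact annulus, where `‖Dⁱ(Φ c − Φ 0)‖ ≤ C ‖c‖`
  (`Literature.Analysis.Calculus.exists_norm_iteratedFDeriv_le_parametric_of_eq_zero`);
* `AFEnd.wDist_restrict_eq` — the weighted distance on the restricted end `e.restrict hR₁` is the
  same `iSup` over `R₁ < ‖x‖` of the chart components of `e` (`hCoeff_restrict`, locality of
  `iteratedFDeriv`);
* `InitialDataSet.isTameDataFamily_restrict_of_agree_off_compact` — **the theorem**: `G` jointly
  smooth (`IsSmoothDataFamily`), `e` a sole end with `e.IsStronglyAsymptoticallyFlatDR (G 0) M`,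
  `G c = G 0` off a compact `K` for all `c` ⟹ `IsTameDataFamily (e.restrict _) m G` for every
  `R₁ > e.R` (constant mass `M`; decay by `IsStronglyAsymptoticallyFlatDR.congr_of_eqOn_far`).

The collar is needed because the chart components are only known to be smooth on the OPEN
exterior region `{‖x‖ > e.R}`; on `{‖x‖ > R₁}`, `R₁ > e.R`, the non-zero differences live on a
compact annulus inside it. Since tame genericity asks for SOME end per exceptional datum, a
collared end serves every consumer (`isTameChristodoulouGeneric_of_relative'`,
`TameGenericityDiagonal.lean`). Christodoulou, CQG 16 (1999) A23, p. A24 (the lines `α₀ + c f`,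
`f` of compact support, in a fixed space `𝓐`); Dafermos–Rodnianski arXiv:0811.0354, App. B.2.3 (the
weights). Everything here is proved; no definitions, no named facts.

Not here: immersion at `0` of such families (a property of the particular family, e.g. the
breathing family's centre scaling), transport of developments along the diffeomorphisms.
-/

noncomputable section

open Set Function Filter Metric TopologicalSpace
open scoped Manifold ContDiff Topology ENNReal

namespace Literature.Geometry.Lorentzian

open Literature.Analysis.Calculus

/-! ### The calculus lemma: weighted `Cⁿ` smallness of a smooth family near a member, the
differences being supported in a bounded region -/

/-- **Weighted `Cⁿ`-suprema of `Φ c − Φ 0` tend to zero as `c → 0`.** Let `Φ : P → E3 → F` be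
jointly `C^∞` at every `(c, z)` with `R < ‖z‖`, and suppose `Φ c z = Φ 0 z` whenever `R₂ < ‖z‖`
(all members agree far out). Then for `R < R₁` and all `n w : ℕ`,
`⨆_{i ≤ n} ⨆_{R₁ < ‖x‖} ‖x‖^{w+i} ‖Dⁱ(Φ c − Φ 0)(x)‖ → 0` as `c → 0` (in `ℝ≥0∞`). Proof: beyond
`R₃ = max R₂ R₁ + 1` the differences vanish identically near every point, so their iterated
derivatives vanish; on the compact annulus `R₁ ≤ ‖x‖ ≤ R₃` (inside the open region of smoothness)
`‖Dⁱ(Φ c − Φ 0)(x)‖ ≤ C ‖c‖` for `‖c‖ ≤ 1` by the parametric mean value inequality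
(`exists_norm_iteratedFDeriv_le_parametric_of_eq_zero`), and the weights are bounded by
`(max R₃ 1)^{w+n}`. Dieudonné 1960, (8.5.4), (8.12.6). [folklore] -/
theorem tendsto_iSup_weight_iteratedFDeriv_sub_nhds_zero
    {P : Type*} [NormedAddCommGroup P] [NormedSpace ℝ P] [ProperSpace P]
    {F : Type*} [NormedAddCommGroup F] [NormedSpace ℝ F]
    {Φ : P → E3 → F} {R R₁ R₂ : ℝ} (hR : R < R₁)
    (hΦ : ∀ (c : P) (z : E3), R < ‖z‖ → ContDiffAt ℝ ∞ (uncurry Φ) (c, z))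
    (hfar : ∀ (c : P) (z : E3), R₂ < ‖z‖ → Φ c z = Φ 0 z) (n w : ℕ) :
    Tendsto (fun c : P ↦ ⨆ (i : ℕ) (_ : i ≤ n) (x : E3) (_ : R₁ < ‖x‖),
      ENNReal.ofReal (‖x‖ ^ (w + i)) * ‖iteratedFDeriv ℝ i (fun y ↦ Φ c y - Φ 0 y) x‖ₑ)
      (𝓝 0) (𝓝 0) := by
  -- the compact annulus on which the differences can be non-zero
  set R₃ : ℝ := max R₂ R₁ + 1 with hR₃
  have hR₃₁ : R₁ < R₃ := by
    have := le_max_right R₂ R₁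
    linarith
  have hR₃₂ : R₂ < R₃ := by
    have := le_max_left R₂ R₁
    linarith
  set L : Set E3 := {x | R₁ ≤ ‖x‖ ∧ ‖x‖ ≤ R₃} with hL
  have hLc : IsCompact L := by
    refine (isCompact_closedBall (0 : E3) R₃).of_isClosed_subset ?_ ?_
    · exact (isClosed_le continuous_const continuous_norm).inter
        (isClosed_le continuous_norm continuous_const)
    · intro x hx
      rw [mem_closedBall_zero_iff]
      exact hx.2
  have hKc : IsCompact (closedBall (0 : P) 1) := isCompact_closedBall 0 1
  have hKconv : Convex ℝ (closedBall (0 : P) 1) := convex_closedBall 0 1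
  have hU : IsOpen {q : P × E3 | R < ‖q.2‖} :=
    isOpen_lt continuous_const (continuous_norm.comp continuous_snd)
  have hKL : closedBall (0 : P) 1 ×ˢ L ⊆ {q : P × E3 | R < ‖q.2‖} :=
    fun q hq ↦ hR.trans_le (mem_prod.1 hq).2.1
  -- the difference family is jointly smooth on the open region
  have hFd : ∀ q ∈ {q : P × E3 | R < ‖q.2‖},
      ContDiffAt ℝ ∞ (fun q : P × E3 ↦ Φ q.1 q.2 - Φ 0 q.2) q := by
    intro q hq
    have h1 : ContDiffAt ℝ ∞ (uncurry Φ) q := hΦ q.1 q.2 hq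
    have h0 : ContDiffAt ℝ ∞ (uncurry Φ) ((fun q' : P × E3 ↦ ((0 : P), q'.2)) q) := hΦ 0 q.2 hq
    have hg : ContDiffAt ℝ ∞ (fun q' : P × E3 ↦ ((0 : P), q'.2)) q :=
      contDiffAt_const.prodMk contDiffAt_snd
    have h2 : ContDiffAt ℝ ∞ (uncurry Φ ∘ fun q' : P × E3 ↦ ((0 : P), q'.2)) q := h0.comp q hg
    have h1' : ContDiffAt ℝ ∞ (fun q' : P × E3 ↦ Φ q'.1 q'.2) q := h1
    have h2' : ContDiffAt ℝ ∞ (fun q' : P × E3 ↦ Φ 0 q'.2) q := h2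
    exact h1'.sub h2'
  have h0 : ∀ y ∈ L, (fun z ↦ (fun q : P × E3 ↦ Φ q.1 q.2 - Φ 0 q.2) ((0 : P), z)) =ᶠ[𝓝 y]
      fun _ ↦ 0 :=
    fun y _ ↦ Eventually.of_forall fun z ↦ by simp
  obtain ⟨C, hC0, hC⟩ := exists_norm_iteratedFDeriv_le_parametric_of_eq_zero hU hFd hKc hKconv
    hLc hKL (mem_closedBall_self zero_le_one) h0 n
  -- weight bound on the annulus
  set W : ℝ := max R₃ 1 ^ (w + n) with hW
  have hW0 : 0 ≤ W := pow_nonneg (zero_le_one.trans (le_max_right _ _)) _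
  have hWle : ∀ x ∈ L, ∀ i ≤ n, ‖x‖ ^ (w + i) ≤ W := by
    intro x hx i hi
    calc ‖x‖ ^ (w + i) ≤ (max R₃ 1) ^ (w + i) :=
          pow_le_pow_left₀ (norm_nonneg _) (hx.2.trans (le_max_left _ _)) _
      _ ≤ (max R₃ 1) ^ (w + n) := pow_le_pow_right₀ (le_max_right _ _) (by omega)
  -- far vanishing of the iterated derivatives
  have hzero : ∀ (c : P) (i : ℕ) (x : E3), R₂ < ‖x‖ →
      iteratedFDeriv ℝ i (fun y ↦ Φ c y - Φ 0 y) x = 0 := by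
    intro c i x hx
    have hev : (fun y ↦ Φ c y - Φ 0 y) =ᶠ[𝓝 x] fun _ ↦ (0 : F) := by
      filter_upwards [(isOpen_lt continuous_const continuous_norm).mem_nhds hx] with y hy
      rw [hfar c y hy, sub_self]
    rw [(hev.iteratedFDeriv ℝ i).eq_of_nhds, iteratedFDeriv_fun_zero, Pi.zero_apply]
  -- the bound for `‖c‖ ≤ 1`
  have hbound : ∀ c : P, ‖c‖ ≤ 1 →
      (⨆ (i : ℕ) (_ : i ≤ n) (x : E3) (_ : R₁ < ‖x‖),
        ENNReal.ofReal (‖x‖ ^ (w + i)) * ‖iteratedFDeriv ℝ i (fun y ↦ Φ c y - Φ 0 y) x‖ₑ) ≤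
        ENNReal.ofReal (W * (C * ‖c‖)) := by
    intro c hc
    refine iSup₂_le fun i hi ↦ iSup₂_le fun x hx ↦ ?_
    by_cases hxL : ‖x‖ ≤ R₃
    · have hxL' : x ∈ L := ⟨hx.le, hxL⟩
      have hcK : c ∈ closedBall (0 : P) 1 := mem_closedBall_zero_iff.2 hc
      have h1 : ‖iteratedFDeriv ℝ i (fun y ↦ Φ c y - Φ 0 y) x‖ ≤ C * ‖c‖ := by
        simpa using hC i hi c hcK x hxL'
      rw [ENNReal.ofReal_mul hW0, ← ofReal_norm]
      exact mul_le_mul' (ENNReal.ofReal_le_ofReal (hWle x hxL' i hi)) (ENNReal.ofReal_le_ofReal h1)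
    · rw [hzero c i x (hR₃₂.trans (not_le.1 hxL))]
      simp
  -- squeeze
  have hg : Tendsto (fun c : P ↦ ENNReal.ofReal (W * (C * ‖c‖))) (𝓝 0) (𝓝 0) := by
    have h : Tendsto (fun c : P ↦ W * (C * ‖c‖)) (𝓝 0) (𝓝 (W * (C * ‖(0 : P)‖))) :=
      (continuous_const.mul (continuous_const.mul continuous_norm)).tendsto 0
    simpa using ENNReal.tendsto_ofReal h
  refine tendsto_of_tendsto_of_tendsto_of_le_of_le' tendsto_const_nhds hg
    (Eventually.of_forall fun c ↦ by simp) ?_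
  filter_upwards [closedBall_mem_nhds (0 : P) one_pos] with c hc
  exact hbound c (mem_closedBall_zero_iff.1 hc)

/-! ### The weighted distance on a restricted end -/

namespace AFEnd

variable {X : Type} [TopologicalSpace X] [ChartedSpace E3 X] [IsManifold (𝓡 3) ∞ X]

/-- **The weighted distance on the collared end `e.restrict hR₁` read through the chart of `e`**:
it is the same pair of weighted `iSup`s, over `R₁ < ‖x‖`, of the chart components `hCoeff e`,
`kCoeff e` of `e` (the restricted end reads the data through the same inverse chart beyond `R₁`,
`hCoeff_restrict` / `kCoeff_restrict`, and `iteratedFDeriv` is local). [folklore] -/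
theorem wDist_restrict_eq (e : AFEnd X) {R₁ : ℝ} (hR₁ : e.R ≤ R₁) (D D' : InitialDataSet (𝓡 3) X) :
    (e.restrict hR₁).wDist D D' =
      (⨆ (m : ℕ) (_ : m ≤ 2) (x : E3) (_ : R₁ < ‖x‖),
          ENNReal.ofReal (‖x‖ ^ (1 + m)) *
            ‖iteratedFDeriv ℝ m (fun y ↦ hCoeff e D y - hCoeff e D' y) x‖ₑ) +
        ⨆ (m : ℕ) (_ : m ≤ 1) (x : E3) (_ : R₁ < ‖x‖),
          ENNReal.ofReal (‖x‖ ^ (2 + m)) *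
            ‖iteratedFDeriv ℝ m (fun y ↦ kCoeff e D y - kCoeff e D' y) x‖ₑ := by
  unfold AFEnd.wDist
  simp only [restrict_R]
  congr 1
  · refine iSup_congr fun m ↦ iSup_congr fun _ ↦ iSup_congr fun x ↦ iSup_congr fun hx ↦ ?_
    have hev : (fun y ↦ hCoeff (e.restrict hR₁) D y - hCoeff (e.restrict hR₁) D' y) =ᶠ[𝓝 x]
        fun y ↦ hCoeff e D y - hCoeff e D' y := by
      filter_upwards [(isOpen_lt continuous_const continuous_norm).mem_nhds hx] with y hy
      rw [e.hCoeff_restrict D hR₁ hy, e.hCoeff_restrict D' hR₁ hy]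
    rw [(hev.iteratedFDeriv ℝ m).eq_of_nhds]
  · refine iSup_congr fun m ↦ iSup_congr fun _ ↦ iSup_congr fun x ↦ iSup_congr fun hx ↦ ?_
    have hev : (fun y ↦ kCoeff (e.restrict hR₁) D y - kCoeff (e.restrict hR₁) D' y) =ᶠ[𝓝 x]
        fun y ↦ kCoeff e D y - kCoeff e D' y := by
      filter_upwards [(isOpen_lt continuous_const continuous_norm).mem_nhds hx] with y hy
      rw [e.kCoeff_restrict D hR₁ hy, e.kCoeff_restrict D' hR₁ hy]
    rw [(hev.iteratedFDeriv ℝ m).eq_of_nhds]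

/-- **Chart components of data agreeing off a far region agree beyond a radius**: if the metrics of
`D'` and `D` agree at every point of `e.far R₀`, then `hCoeff e D' z = hCoeff e D z` for
`max R₀ e.R < ‖z‖` (the inverse chart lands in `far R₀` there). [cite: Bartnik1986, (1.3)] -/
theorem hCoeff_eq_of_agree_far (e : AFEnd X) {D D' : InitialDataSet (𝓡 3) X} {R₀ : ℝ}
    (hh : ∀ q ∈ e.far R₀, D'.h.inner q = D.h.inner q) {z : E3} (hz : max R₀ e.R < ‖z‖) :
    hCoeff e D' z = hCoeff e D z := by
  have hzR : e.R < ‖z‖ := (le_max_right _ _).trans_lt hz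
  have hfar : e.dataChartExt z ∈ e.far R₀ := by
    rw [e.dataChartExt_of_lt hzR, e.dataChart_mem_far_iff]
    exact (le_max_left _ _).trans_lt hz
  ext v w
  rw [e.hCoeff_apply_eq_dataChartExt D' hzR, e.hCoeff_apply_eq_dataChartExt D hzR, hh _ hfar]

/-- The same for the components of `k`. [cite: ChristodoulouKlainerman1993, (1.0.9)] -/
theorem kCoeff_eq_of_agree_far (e : AFEnd X) {D D' : InitialDataSet (𝓡 3) X} {R₀ : ℝ}
    (hk : ∀ q ∈ e.far R₀, D'.k q = D.k q) {z : E3} (hz : max R₀ e.R < ‖z‖) :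
    kCoeff e D' z = kCoeff e D z := by
  have hzR : e.R < ‖z‖ := (le_max_right _ _).trans_lt hz
  have hfar : e.dataChartExt z ∈ e.far R₀ := by
    rw [e.dataChartExt_of_lt hzR, e.dataChart_mem_far_iff]
    exact (le_max_left _ _).trans_lt hz
  ext v w
  rw [e.kCoeff_apply_eq_dataChartExt D' hzR, e.kCoeff_apply_eq_dataChartExt D hzR, hk _ hfar]

end AFEnd

/-! ### The theorem -/

namespace InitialDataSet

variable {X : Type} [TopologicalSpace X] [ChartedSpace E3 X] [IsManifold (𝓡 3) ∞ X]

/-- **A jointly smooth family of data, constant off a compact set, is TAME on every collared end.**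
Let `G : ℝᵐ → InitialDataSet (𝓡 3) X` be jointly smooth (`IsSmoothDataFamily`), let `e` be a sole
end of `X` on which `G 0` is Dafermos–Rodnianski flat with mass `M`, and suppose every member `G c`
has the same metric and second fundamental form as `G 0` at every point outside a fixed compact set
`K`. Then for every `R₁ > e.R` the family is tame on the collared end `e.restrict _`
(`IsTameDataFamily`): it is jointly smooth; the collared end is sole (`isSoleEnd_restrict_iff`);
every member is DR-flat there with the SAME mass `M` (the sections agree on a far region,
`IsStronglyAsymptoticallyFlatDR.congr_of_eqOn_far`, and decay is unchanged by the collar); and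
`wDist (G c) (G 0) → 0` as `c → 0`, because the weighted `C² × C¹` differences of the chart
components live on a compact annulus where they are `O(‖c‖)` uniformly
(`tendsto_iSup_weight_iteratedFDeriv_sub_nhds_zero`, fed by the joint smoothness of the chart
components of a smooth family, `AFEnd.contDiffAt_hCoeff_family` / `contDiffAt_kCoeff_family`).
This makes Christodoulou's compactly supported witness lines `α₀ + c f` (CQG 16 (1999), p. A24)
and every gluing / breathing / gauge-enrichment family of the tree legal witnesses for the TAME
genericity of the final state conjecture. [cite: Christodoulou1999, p. A24] -/
theorem isTameDataFamily_restrict_of_agree_off_compact {e : AFEnd X} {m : ℕ}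
    {G : EuclideanSpace ℝ (Fin m) → InitialDataSet (𝓡 3) X} (hG : IsSmoothDataFamily m G)
    (he : e.IsSoleEnd) {M : ℝ} (hSAF : e.IsStronglyAsymptoticallyFlatDR (G 0) M)
    {K : Set X} (hK : IsCompact K)
    (hagree : ∀ c, ∀ x ∉ K, (G c).h.inner x = (G 0).h.inner x ∧ (G c).k x = (G 0).k x)
    {R₁ : ℝ} (hR₁ : e.R < R₁) :
    IsTameDataFamily (e.restrict hR₁.le) m G := by
  -- a far region of `e` missing `K`, on which all members agree with `G 0`
  obtain ⟨R₀, hR₀⟩ := e.exists_forall_far_disjoint hK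
  have hagree_far : ∀ c, ∀ q ∈ e.far R₀,
      (G c).h.inner q = (G 0).h.inner q ∧ (G c).k q = (G 0).k q :=
    fun c q hq ↦ hagree c q fun hqK ↦ Set.disjoint_left.1 (hR₀ R₀ le_rfl) hq hqK
  -- hence the chart components agree beyond `max R₀ e.R`
  have hh : ∀ (c : EuclideanSpace ℝ (Fin m)) (z : E3), max R₀ e.R < ‖z‖ →
      e.hCoeff (G c) z = e.hCoeff (G 0) z :=
    fun c z hz ↦ e.hCoeff_eq_of_agree_far (fun q hq ↦ (hagree_far c q hq).1) hz
  have hk : ∀ (c : EuclideanSpace ℝ (Fin m)) (z : E3), max R₀ e.R < ‖z‖ →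
      e.kCoeff (G c) z = e.kCoeff (G 0) z :=
    fun c z hz ↦ e.kCoeff_eq_of_agree_far (fun q hq ↦ (hagree_far c q hq).2) hz
  refine ⟨hG, (e.isSoleEnd_restrict_iff hR₁.le).2 he, ⟨fun _ ↦ M, continuous_const, fun c ↦ ?_⟩, ?_⟩
  · -- decay of each member on the collared end, same mass
    rw [e.isStronglyAsymptoticallyFlatDR_restrict_iff hR₁.le]
    exact hSAF.congr_of_eqOn_far (R₀ := R₀) (fun q hq ↦ (hagree_far c q hq).1)
      (fun q hq ↦ (hagree_far c q hq).2)
  · -- `wDist`-continuity at the base parameter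
    have hA := tendsto_iSup_weight_iteratedFDeriv_sub_nhds_zero
      (Φ := fun (c : EuclideanSpace ℝ (Fin m)) (z : E3) ↦ e.hCoeff (G c) z) hR₁
      (fun c z hz ↦ AFEnd.contDiffAt_hCoeff_family hG.1 c hz) hh 2 1
    have hB := tendsto_iSup_weight_iteratedFDeriv_sub_nhds_zero
      (Φ := fun (c : EuclideanSpace ℝ (Fin m)) (z : E3) ↦ e.kCoeff (G c) z) hR₁
      (fun c z hz ↦ AFEnd.contDiffAt_kCoeff_family hG.2 c hz) hk 1 2
    have hsum := hA.add hB
    rw [add_zero] at hsum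
    refine hsum.congr' (Eventually.of_forall fun c ↦ ?_)
    exact (e.wDist_restrict_eq hR₁.le (G c) (G 0)).symm

/-- **Corollary (curves).** A jointly smooth one-parameter family of data agreeing with its base
member off a compact set is a tame curve on every collared restriction of a sole, DR-flat end of the
base member — the case `m = 1` used by witness curves of tame Christodoulou genericity.
[cite: Christodoulou1999, p. A24] -/
theorem isTameDataFamily_restrict_of_agree_off_compact_one {e : AFEnd X}
    {F : EuclideanSpace ℝ (Fin 1) → InitialDataSet (𝓡 3) X} (hF : IsSmoothDataFamily 1 F)
    (he : e.IsSoleEnd) {M : ℝ} (hSAF : e.IsStronglyAsymptoticallyFlatDR (F 0) M)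
    {K : Set X} (hK : IsCompact K)
    (hagree : ∀ c, ∀ x ∉ K, (F c).h.inner x = (F 0).h.inner x ∧ (F c).k x = (F 0).k x)
    {R₁ : ℝ} (hR₁ : e.R < R₁) :
    IsTameDataFamily (e.restrict hR₁.le) 1 F :=
  isTameDataFamily_restrict_of_agree_off_compact hF he hSAF hK hagree hR₁

end InitialDataSet

end Literature.Geometry.Lorentzian

end
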